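import Summits.FinalStateConjecture.FinalStateConjecture.Theorems.EIHFluxBalanceInertialRecessionStubSlaving3Coercive
import Summits.FinalStateConjecture.FinalStateConjecture.Theorems.EIHFluxBalanceInertialRecessionStubSlaving3Perturb
import Summits.FinalStateConjecture.FinalStateConjecture.Theorems.EIHFluxBalanceInertialRecessionAnsatzSmooth

/-!
# Route EIHFluxBalance — `InertialRecession`, line `sublinear-is-free-clean-window-charges`:
# the frozen ansatz is asymptotically Ricci-flat RELATIVE TO ITS OWN 2-JET near every hole
# (slaving stub `stub_slaving`)

Helper file for the crux `stmt-FinalStateConjecture-10166`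
(`Summit.FinalStateConjecture.FinalStateConjecture.Theses.EIHFluxBalance.InertialRecession`),
stub `stub_slaving`. The analytic half of the slaving mechanism, at the level of the full
multi-hole ansatz `g₀ = η + Σⱼ (boostedKerrBilin (Λⱼ(x⁰)) (x⁰, ξⱼ(x⁰)) Mⱼ aⱼ − η)`: from four clauses
of the crux antecedent only (Lorentz factors `≤ γ`, smooth motions, separating centres, `C²`
deviation `→ 0` on lab slabs) and the vacuum equations of the development:

* `exists_abs_ricAt_ansatz_le_jet` — **capstone**: for every hole `i`, lab radius `R`, painted
  floor `r₀ > 0` and `ε > 0` there is a lab time `T` after which, at every chart point of the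
  hole-following tube `{x⁰ > T, ‖x̲ − ξᵢ(x⁰)‖ < R, rᵢ > r₀}`,
  `|Ric(g₀)(x)(Y, Z)| ≤ ε (1 + ‖Dg₀(x)‖² + ‖D²g₀(x)‖) ‖Y‖ ‖Z‖`
  — the Ricci form of the FROZEN ansatz is small relative to its own `2`-jet (whose size, the
  painted velocities/accelerations, is NOT bounded a priori). Proof: `Ric((Φ^*g − g₀) + g₀) = 0`
  on the tube (`ricAt_deviationExtend_add_bilin_eq_zero_of_vacuum`, `…StubSlavingHelpers`, with
  `dΦ` injective there by `eventually_coercive_near_hole`, `…StubSlaving3Coercive`), and the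
  jet-sharp perturbation estimate `abs_ricAt_le_of_ricAt_eq_zero_jet` (`…StubSlaving3Perturb`) with
  `s = 4/m` and the `C²` deviation `< δ(ε, m)`.

What remains for `SLAVED³` after this file is purely about the frozen ansatz: separating the other
holes' summands (far-field bounds in the effective jets of their own holes, via
`…StubSlaving3JetScaling`) and the algebraic coercivity of the jet ↦ Ricci map of ONE modulated
summand (see the worker hand-off).
-/

set_option linter.dupNamespace false
set_option maxSynthPendingDepth 3

noncomputable section

open scoped Topology Manifold ContDiff
open Filter Set Function TopologicalSpace Literature.Geometry.Lorentzian
  Summit.FinalStateConjecture.FinalStateConjecture.Theorems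

namespace Summit.FinalStateConjecture.FinalStateConjecture.Theorems.SublinearIsFree.Slaving

/-! ### Capstone: `Ric(g₀)` is small relative to the `2`-jet of `g₀` near each hole -/

/-- The arithmetic of the capstone: with `d₀, d₁, d₂ ≤ δ ≤ 1`, `1 ≤ s` and `240 s³ δ ≤ ε`,
`12 (s³ (5 (n₁ + d₁)² + (n₂ + d₂)) d₀ + 5 s² (n₁ + d₁) d₁ + s d₂) ≤ ε (1 + n₁² + n₂)`. [folklore] -/
theorem slaving_capstone_arith {s δ ε n₁ n₂ d₀ d₁ d₂ : ℝ} (h1s : 1 ≤ s) (hδ0 : 0 ≤ δ) (hδ1 : δ ≤ 1)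
    (hε : 240 * s ^ 3 * δ ≤ ε) (hn₁ : 0 ≤ n₁) (hn₂ : 0 ≤ n₂) (hd₀ : 0 ≤ d₀) (hd₁ : 0 ≤ d₁)
    (hd₂ : 0 ≤ d₂) (h₀ : d₀ ≤ δ) (h₁ : d₁ ≤ δ) (h₂ : d₂ ≤ δ) :
    3 * (4 : ℕ) * (s ^ 3 * (5 * (n₁ + d₁) ^ 2 + (n₂ + d₂)) * d₀ + 5 * s ^ 2 * (n₁ + d₁) * d₁
      + s * d₂) ≤ ε * (1 + n₁ ^ 2 + n₂) := by
  have hs0 : 0 ≤ s := zero_le_one.trans h1s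
  have hs2 : s ^ 2 ≤ s ^ 3 := pow_le_pow_right₀ h1s (by norm_num)
  have hs1 : s ≤ s ^ 3 := by
    calc s = s ^ 1 := (pow_one s).symm
      _ ≤ s ^ 3 := pow_le_pow_right₀ h1s (by norm_num)
  have hd11 : d₁ ≤ 1 := h₁.trans hδ1
  have hd21 : d₂ ≤ 1 := h₂.trans hδ1
  have T1 : s ^ 3 * (5 * (n₁ + d₁) ^ 2 + (n₂ + d₂)) * d₀ ≤
      s ^ 3 * (5 * (n₁ + 1) ^ 2 + (n₂ + 1)) * δ := by
    have e1 : (n₁ + d₁) ^ 2 ≤ (n₁ + 1) ^ 2 := by nlinarith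
    have e2 : 5 * (n₁ + d₁) ^ 2 + (n₂ + d₂) ≤ 5 * (n₁ + 1) ^ 2 + (n₂ + 1) := by linarith
    have e3 : 0 ≤ 5 * (n₁ + d₁) ^ 2 + (n₂ + d₂) := by positivity
    calc s ^ 3 * (5 * (n₁ + d₁) ^ 2 + (n₂ + d₂)) * d₀
        ≤ s ^ 3 * (5 * (n₁ + 1) ^ 2 + (n₂ + 1)) * d₀ := by gcongr
      _ ≤ s ^ 3 * (5 * (n₁ + 1) ^ 2 + (n₂ + 1)) * δ := by gcongr
  have T2 : 5 * s ^ 2 * (n₁ + d₁) * d₁ ≤ 5 * s ^ 3 * (n₁ + 1) * δ := by gcongr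
  have T3 : s * d₂ ≤ s ^ 3 * δ := by gcongr
  have key : 5 * (n₁ + 1) ^ 2 + (n₂ + 1) + 5 * (n₁ + 1) + 1 ≤ 20 * (1 + n₁ ^ 2 + n₂) := by
    nlinarith [sq_nonneg (n₁ - 1)]
  have hmain : s ^ 3 * (5 * (n₁ + d₁) ^ 2 + (n₂ + d₂)) * d₀ + 5 * s ^ 2 * (n₁ + d₁) * d₁ + s * d₂
      ≤ s ^ 3 * δ * (20 * (1 + n₁ ^ 2 + n₂)) := by
    have h := add_le_add (add_le_add T1 T2) T3
    refine h.trans ?_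
    have : s ^ 3 * (5 * (n₁ + 1) ^ 2 + (n₂ + 1)) * δ + 5 * s ^ 3 * (n₁ + 1) * δ + s ^ 3 * δ =
        s ^ 3 * δ * (5 * (n₁ + 1) ^ 2 + (n₂ + 1) + 5 * (n₁ + 1) + 1) := by ring
    rw [this]
    exact mul_le_mul_of_nonneg_left key (by positivity)
  have hpos : 0 ≤ 1 + n₁ ^ 2 + n₂ := by positivity
  calc 3 * ((4 : ℕ) : ℝ) * (s ^ 3 * (5 * (n₁ + d₁) ^ 2 + (n₂ + d₂)) * d₀
        + 5 * s ^ 2 * (n₁ + d₁) * d₁ + s * d₂)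
      ≤ 3 * (4 : ℕ) * (s ^ 3 * δ * (20 * (1 + n₁ ^ 2 + n₂))) := by
        push_cast
        exact mul_le_mul_of_nonneg_left hmain (by norm_num)
    _ = (240 * s ^ 3 * δ) * (1 + n₁ ^ 2 + n₂) := by push_cast; ring
    _ ≤ ε * (1 + n₁ ^ 2 + n₂) := mul_le_mul_of_nonneg_right hε hpos

set_option maxHeartbeats 1600000 in
/-- **The frozen ansatz is asymptotically Ricci-flat relative to its own `2`-jet, near every hole.**
For a vacuum Cauchy development `𝒟`, painted moduli with smooth motions, Lorentz factors `≤ γ` and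
separating centres, and a smooth chart map `Φ : U → 𝒟` whose `C²` deviation from the modulated
background `g₀ = η + Σⱼ (boostedKerrBilin (Λⱼ(x⁰)) (x⁰, ξⱼ(x⁰)) Mⱼ aⱼ − η)` tends to `0` on the
lab slabs: for every hole `i`, lab radius `R`, painted floor `r₀ > 0` and `ε > 0` there is a lab
time `T` after which, at every chart point `x` of the hole-following tube
`{x⁰ > T, ‖x̲ − ξᵢ(x⁰)‖ < R, rᵢ(x) > r₀}` and for all `Y, Z`,
`|Ric(g₀)(x)(Y, Z)| ≤ ε (1 + ‖Dg₀(x)‖² + ‖D²g₀(x)‖) ‖Y‖ ‖Z‖`.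
(Vacuum equations in the lab chart, `ricAt_deviationExtend_add_bilin_eq_zero_of_vacuum`, on the
tube where `dΦ` is injective by `eventually_coercive_near_hole`; jet-sharp perturbation estimate
`abs_ricAt_le_of_ricAt_eq_zero_jet` with `s = 4/m`.) This is the analytic input of the slaving
statement `SLAVED³`; the jets of `g₀` are not bounded a priori, which is why the bound is relative.
[folklore] -/
theorem exists_abs_ricAt_ansatz_le_jet
    {X : Type*} [TopologicalSpace X] [ChartedSpace E3 X] [IsManifold (𝓡 3) ∞ X]
    [ConnectedSpace X] {D : InitialDataSet (𝓡 3) X} (𝒟 : VacuumCauchyDevelopment D)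
    {N : ℕ} {M a : Fin N → ℝ} {Λ : Fin N → ℝ → lorentzGroup} {ξ : Fin N → ℝ → E3} {γ : ℝ}
    {U : Opens E4}
    (hγ : ∀ i t, |((Λ i t : E4 ≃L[ℝ] E4) (E4.basisVector 0)) 0| ≤ γ)
    (hsm : ∀ i, ContDiff ℝ ((⊤ : ℕ∞) : WithTop ℕ∞) (ξ i) ∧
      ContDiff ℝ ((⊤ : ℕ∞) : WithTop ℕ∞) (fun t ↦ ((Λ i t : E4 ≃L[ℝ] E4) : E4 →L[ℝ] E4)))
    (hsep : ∀ i j, i ≠ j → Tendsto (fun t ↦ ‖ξ i t - ξ j t‖) atTop atTop)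
    {Φ : U → 𝒟.carrier} (hΦ : ContMDiff 𝓘(ℝ, E4) (𝓡 4) ∞ Φ)
    (hdev : Tendsto (fun t ↦ 𝒟.toSpacetime.deviationCk ⟨U, fun x ↦ Minkowski.bilin +
      ∑ i, (boostedKerrBilin (Λ i (x 0)) (E4.ofTimeSpace (x 0) (ξ i (x 0))) (M i) (a i) x -
        Minkowski.bilin), fun x ↦ x 0, E4.spatialNorm⟩ Φ 2 t) atTop (𝓝 0))
    (i : Fin N) (R : ℝ) {r₀ : ℝ} (hr₀ : 0 < r₀) {ε : ℝ} (hε : 0 < ε) :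
    ∃ T : ℝ, ∀ x : U, T < x.1 0 → ‖E4.spatial x.1 - ξ i (x.1 0)‖ < R →
      r₀ < Kerr.radius (a i) (poincareInv (Λ i (x.1 0)) (E4.ofTimeSpace (x.1 0) (ξ i (x.1 0))) x.1) →
      ∀ Y Z : E4, |MetricCoord.ricAt (fun z : E4 ↦ Minkowski.bilin +
        ∑ i, (boostedKerrBilin (Λ i (z 0)) (E4.ofTimeSpace (z 0) (ξ i (z 0))) (M i) (a i) z -
          Minkowski.bilin)) x.1 Y Z| ≤
        ε * (1 + ‖fderiv ℝ (fun z : E4 ↦ Minkowski.bilin +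
          ∑ i, (boostedKerrBilin (Λ i (z 0)) (E4.ofTimeSpace (z 0) (ξ i (z 0))) (M i) (a i) z -
            Minkowski.bilin)) x.1‖ ^ 2 + ‖fderiv ℝ (fderiv ℝ (fun z : E4 ↦ Minkowski.bilin +
          ∑ i, (boostedKerrBilin (Λ i (z 0)) (E4.ofTimeSpace (z 0) (ξ i (z 0))) (M i) (a i) z -
            Minkowski.bilin))) x.1‖) * ‖Y‖ * ‖Z‖ := by
  set gB : E4 → E4 →L[ℝ] E4 →L[ℝ] ℝ := fun z ↦ Minkowski.bilin +
      ∑ i, (boostedKerrBilin (Λ i (z 0)) (E4.ofTimeSpace (z 0) (ξ i (z 0))) (M i) (a i) z -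
        Minkowski.bilin) with hgB
  set B : ModelBackground := ⟨U, gB, fun x ↦ x 0, E4.spatialNorm⟩ with hB
  set e : E4 → E4 →L[ℝ] E4 →L[ℝ] ℝ := 𝒟.toSpacetime.deviationExtend B Φ with he
  -- constants
  have hγ1 : 1 ≤ γ := (one_le_abs_lorentz_apply_zero (Λ i 0)).trans (hγ i 0)
  set K : ℝ := (1 + 3 * γ) ^ 2 * (1 + 4 * (|M i| / r₀)) with hK
  have hK1 : 1 ≤ K := by
    have h1 : (1 : ℝ) ≤ (1 + 3 * γ) ^ 2 := by nlinarith
    have h2 : (1 : ℝ) ≤ 1 + 4 * (|M i| / r₀) := by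
      have : 0 ≤ |M i| / r₀ := by positivity
      linarith
    nlinarith
  have hK0 : 0 < K := by linarith
  set m : ℝ := K⁻¹ with hm
  have hm0 : 0 < m := inv_pos.mpr hK0
  have hm1 : m ≤ 1 := inv_le_one_of_one_le₀ hK1
  set s : ℝ := 4 / m with hs
  have h1s : 1 ≤ s := by
    rw [hs, le_div_iff₀ hm0]; linarith
  have hs0 : 0 < s := by positivity
  set δ : ℝ := min 1 (ε / (240 * s ^ 3)) with hδ
  have hδ0 : 0 < δ := lt_min one_pos (by positivity)
  have hδ1 : δ ≤ 1 := min_le_left _ _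
  have hδε : 240 * s ^ 3 * δ ≤ ε := by
    have : δ ≤ ε / (240 * s ^ 3) := min_le_right _ _
    rwa [le_div_iff₀ (by positivity), mul_comm] at this
  -- late times: coercivity near hole `i` and `C²`-smallness of the deviation
  have hdev0 : Tendsto (fun t ↦ 𝒟.toSpacetime.deviationCk B Φ 0 t) atTop (𝓝 0) :=
    tendsto_of_tendsto_of_tendsto_of_le_of_le tendsto_const_nhds hdev (fun _ ↦ bot_le)
      fun t ↦ 𝒟.toSpacetime.deviationCk_mono B Φ (Nat.zero_le 2) t
  have E1 := eventually_coercive_near_hole 𝒟.toSpacetime hγ hsep hdev0 i R hr₀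
  have E2 : ∀ᶠ t in atTop, 𝒟.toSpacetime.deviationCk B Φ 2 t < ENNReal.ofReal δ :=
    (tendsto_order.1 hdev).2 _ (ENNReal.ofReal_pos.2 hδ0)
  obtain ⟨T, hT⟩ := eventually_atTop.1 (E1.and E2)
  refine ⟨T, fun x hxT hxR hxr Y Z ↦ ?_⟩
  -- the open hole-following tube
  have hrad : Continuous (fun z : E4 ↦ Kerr.radius (a i)
      (poincareInv (Λ i (z 0)) (E4.ofTimeSpace (z 0) (ξ i (z 0))) z)) := by
    have hΛc : Continuous (fun s ↦ (((Λ i s : E4 ≃L[ℝ] E4).symm : E4 →L[ℝ] E4))) :=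
      (SublinearIsFree.Slaving.contDiff_lorentz_symm (hsm i).2).continuous
    have h0 : Continuous (fun x : E4 ↦ x 0) := (EuclideanSpace.proj (0 : Fin 4)).continuous
    have hc : Continuous (fun x : E4 ↦ E4.ofTimeSpace (x 0) (ξ i (x 0))) := by
      have : (fun x : E4 ↦ E4.ofTimeSpace (x 0) (ξ i (x 0))) =
          fun x ↦ (x 0) • E4.basisVector 0 + E4.spaceEmbed (ξ i (x 0)) :=
        funext fun x ↦ E4.ofTimeSpace_eq_smul_add' (x 0) (ξ i (x 0))
      rw [this]
      exact (h0.smul continuous_const).add (E4.spaceEmbed.continuous.comp ((hsm i).1.continuous.comp h0))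
    have hp : Continuous (fun x : E4 ↦ poincareInv (Λ i (x 0)) (E4.ofTimeSpace (x 0) (ξ i (x 0))) x) :=
      (hΛc.comp h0).clm_apply (continuous_id.sub hc)
    exact (Kerr.continuous_radius (a i)).comp hp
  have hdist : Continuous (fun z : E4 ↦ ‖E4.spatial z - ξ i (z 0)‖) :=
    (E4.spatial.continuous.sub
      ((hsm i).1.continuous.comp (EuclideanSpace.proj (0 : Fin 4)).continuous)).norm
  let A : Opens E4 := ⟨{z : E4 | z ∈ (U : Set E4) ∧ T < z 0 ∧ ‖E4.spatial z - ξ i (z 0)‖ < R ∧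
      r₀ < Kerr.radius (a i) (poincareInv (Λ i (z 0)) (E4.ofTimeSpace (z 0) (ξ i (z 0))) z)},
    U.isOpen.inter ((isOpen_lt continuous_const (EuclideanSpace.proj (0 : Fin 4)).continuous).inter
      ((isOpen_lt hdist continuous_const).inter (isOpen_lt continuous_const hrad)))⟩
  have hA : A ≤ B.domain := fun z hz ↦ hz.1
  -- the three facts of `eventually_coercive_near_hole` at every point of the tube
  have hfacts : ∀ z : E4, ∀ hz : z ∈ (A : Set E4),
      (∀ j, 0 < Kerr.radius (a j) (poincareInv (Λ j (z 0)) (E4.ofTimeSpace (z 0) (ξ j (z 0))) z)) ∧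
      (∀ v : E4, m / 2 * ‖v‖ ≤ ‖gB z v‖) ∧
      ‖𝒟.toSpacetime.deviation B Φ ⟨z, hz.1⟩‖ < m / 4 ∧
      𝒟.toSpacetime.deviationCk B Φ 2 (z 0) < ENNReal.ofReal δ := by
    intro z hz
    obtain ⟨hzU, hzT, hzR, hzr⟩ := hz
    obtain ⟨h1, h2⟩ := hT (z 0) hzT.le
    obtain ⟨hr, hc, hd⟩ := h1 ⟨z, hzU⟩ rfl hzR.le hzr.le
    exact ⟨hr, hc, hd, h2⟩
  -- `dΦ` is injective on the tube
  have hinj : ∀ y : A, Function.Injective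
      (mfderiv 𝓘(ℝ, E4) (𝓡 4) Φ (Opens.inclusion hA y)) := by
    intro y
    obtain ⟨_, hc, hd, _⟩ := hfacts y.1 y.2
    -- a kernel vector `v` of `dΦ` has `(Φ^*g)(v,·) = 0`, so `‖g₀(v,·)‖ = ‖dev(v,·)‖ < (m/2)‖v‖`
    have hd' : ‖𝒟.toSpacetime.deviation B Φ (Opens.inclusion hA y)‖ < m / 2 := hd.trans (by linarith)
    rw [injective_iff_map_eq_zero]
    intro v hv
    change E4 at v
    by_contra hne
    have hvpos : 0 < ‖v‖ := norm_pos_iff.mpr hne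
    have hdv : 𝒟.toSpacetime.deviation B Φ (Opens.inclusion hA y) v = -(gB y.1 v) := by
      ext w
      rw [𝒟.toSpacetime.deviation_apply, hv, map_zero, zero_apply, zero_sub]
      rfl
    have h1 : ‖gB y.1 v‖ ≤ ‖𝒟.toSpacetime.deviation B Φ (Opens.inclusion hA y)‖ * ‖v‖ := by
      rw [← norm_neg, ← hdv]
      exact (𝒟.toSpacetime.deviation B Φ (Opens.inclusion hA y)).le_opNorm v
    have h2 : m / 2 * ‖v‖ < m / 2 * ‖v‖ :=
      lt_of_le_of_lt ((hc v).trans h1) (mul_lt_mul_of_pos_right hd' hvpos)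
    exact lt_irrefl _ h2
  -- both component fields are metric components on the tube
  have hG : MetricCoord.IsMetricOn (fun z ↦ e z + gB z) (A : Set E4) :=
    isMetricOn_labMetric 𝒟.toSpacetime B hΦ hA hinj
  have hG' : MetricCoord.IsMetricOn gB (A : Set E4) := by
    refine ⟨A.isOpen, fun z hz ↦ ?_, fun z _ v w ↦ ?_, fun z hz ↦ ?_⟩
    · exact (contDiffAt_ansatzBilin' N M a Λ ξ (fun j ↦ (hsm j).2) (fun j ↦ (hsm j).1) z
        (hfacts z hz).1).contDiffWithinAt
    · show (Minkowski.bilin + ∑ i, (boostedKerrBilin (Λ i (z 0)) (E4.ofTimeSpace (z 0) (ξ i (z 0)))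
        (M i) (a i) z - Minkowski.bilin)) v w = (Minkowski.bilin + ∑ i, (boostedKerrBilin (Λ i (z 0))
        (E4.ofTimeSpace (z 0) (ξ i (z 0))) (M i) (a i) z - Minkowski.bilin)) w v
      simp only [add_apply, FunLike.coe_sum, Finset.sum_apply,
        sub_apply, Minkowski.bilin_symm v w, boostedKerrBilin_symm _ _ _ _ z v w]
    · refine MetricCoord.isInvertible_of_nondegenerate fun v hv ↦ ?_
      have h0 : gB z v = 0 := ContinuousLinearMap.ext fun w ↦ hv w
      have h1 := (hfacts z hz).2.1 v
      rw [h0, norm_zero] at h1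
      have h2 : ‖v‖ ≤ 0 := by nlinarith
      exact norm_le_zero_iff.1 h2
  -- the point
  have hx : x.1 ∈ (A : Set E4) := ⟨x.2, hxT, hxR, hxr⟩
  obtain ⟨hxrad, hxc, hxd, hx2⟩ := hfacts x.1 hx
  -- the vacuum equations at `x`
  have h0 : MetricCoord.ricAt (fun z ↦ e z + gB z) x.1 = 0 :=
    ContinuousLinearMap.ext fun v ↦ ContinuousLinearMap.ext fun w ↦
      ricAt_deviationExtend_add_bilin_eq_zero_of_vacuum 𝒟 B hΦ hA hinj ⟨x.1, hx⟩ v w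
  -- `♯` bounds
  have hxd' : ‖𝒟.toSpacetime.deviation B Φ x‖ < m / 4 := by
    have : (⟨x.1, hx.1⟩ : U) = x := Subtype.ext rfl
    rwa [this] at hxd
  have hex : e x.1 = 𝒟.toSpacetime.deviation B Φ x := 𝒟.toSpacetime.deviationExtend_coe B Φ x
  have hs' : ‖MetricCoord.sharpAt gB x.1‖ ≤ s := by
    have h := norm_sharpAt_le_of_coercive (G := gB) (x := x.1) (by positivity : 0 < m / 2) hxc
      (hG'.isInvertible x.1 hx)
    refine h.trans ?_
    rw [hs, inv_div]; gcongr; norm_num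
  have hsG : ‖MetricCoord.sharpAt (fun z ↦ e z + gB z) x.1‖ ≤ s := by
    have hcoer : ∀ v : E4, (m / 2 - m / 4) * ‖v‖ ≤ ‖(gB x.1 + e x.1) v‖ := fun v ↦
      coercive_add_of_norm_le hxc (by rw [hex]; exact hxd'.le) v
    have hcoer' : ∀ v : E4, m / 4 * ‖v‖ ≤ ‖(fun z ↦ e z + gB z) x.1 v‖ := by
      intro v
      have := hcoer v
      rw [show m / 2 - m / 4 = m / 4 by ring, add_comm] at this
      exact this
    have h := norm_sharpAt_le_of_coercive (G := fun z ↦ e z + gB z) (x := x.1)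
      (by positivity : 0 < m / 4) hcoer' (hG.isInvertible x.1 hx)
    refine h.trans (le_of_eq ?_)
    rw [hs, inv_div]
  -- the jet-sharp perturbation estimate
  have hmain := abs_ricAt_le_of_ricAt_eq_zero_jet hG hG' hx h0 h1s hsG hs' Y Z
  -- the `2`-jet of the deviation at `x` is `≤ δ`
  have hmem : x.1 ∈ Subtype.val '' B.timeSlab (x.1 0) := ⟨x, rfl, rfl⟩
  have hdevk : ∀ k ≤ 2, ‖iteratedFDeriv ℝ k e x.1‖ ≤ δ := by
    intro k hk
    have h1 := enorm_iteratedFDeriv_le_supCkENorm hk hmem e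
    rw [← ofReal_norm] at h1
    have h2 : ENNReal.ofReal ‖iteratedFDeriv ℝ k e x.1‖ < ENNReal.ofReal δ := h1.trans_lt hx2
    exact ((ENNReal.ofReal_lt_ofReal_iff hδ0).1 h2).le
  -- smoothness of `e` and `gB` at `x`
  have hgBx : ContDiffAt ℝ ∞ gB x.1 := hG'.contDiffOn.contDiffAt (A.isOpen.mem_nhds hx)
  have hGx : ContDiffAt ℝ ∞ (fun z ↦ e z + gB z) x.1 := hG.contDiffOn.contDiffAt (A.isOpen.mem_nhds hx)
  have hex' : e = fun z ↦ (e z + gB z) - gB z := funext fun z ↦ (add_sub_cancel_right _ _).symm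
  have hecd : ContDiffOn ℝ ∞ e (A : Set E4) := by
    rw [hex']; exact hG.contDiffOn.sub hG'.contDiffOn
  have hez : ∀ z ∈ (A : Set E4), ContDiffAt ℝ ∞ e z := fun z hz ↦
    hecd.contDiffAt (A.isOpen.mem_nhds hz)
  have hgBz : ∀ z ∈ (A : Set E4), ContDiffAt ℝ ∞ gB z := fun z hz ↦
    hG'.contDiffOn.contDiffAt (A.isOpen.mem_nhds hz)
  -- d₀
  have hd₀ : ‖(fun z ↦ e z + gB z) x.1 - gB x.1‖ ≤ δ := by
    have : (fun z ↦ e z + gB z) x.1 - gB x.1 = e x.1 := add_sub_cancel_right _ _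
    rw [this, ← norm_iteratedFDeriv_zero (𝕜 := ℝ)]
    exact hdevk 0 (Nat.zero_le 2)
  -- d₁
  have hfd : ∀ z ∈ (A : Set E4), fderiv ℝ (fun z ↦ e z + gB z) z = fderiv ℝ e z + fderiv ℝ gB z :=
    fun z hz ↦ fderiv_add ((hez z hz).differentiableAt (by simp)) ((hgBz z hz).differentiableAt (by simp))
  have hd₁ : ‖fderiv ℝ (fun z ↦ e z + gB z) x.1 - fderiv ℝ gB x.1‖ ≤ δ := by
    rw [hfd x.1 hx, add_sub_cancel_right, (norm_fderiv_eq_norm_iteratedFDeriv e x.1).1]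
    exact hdevk 1 (by norm_num)
  -- d₂
  have hfd' : fderiv ℝ (fun z ↦ e z + gB z) =ᶠ[𝓝 x.1] fun z ↦ fderiv ℝ e z + fderiv ℝ gB z :=
    Filter.eventually_of_mem (A.isOpen.mem_nhds hx) hfd
  have h2top : (1 : WithTop ℕ∞) + 1 ≤ ∞ := by
    rw [show ((1 : WithTop ℕ∞) + 1) = ((2 : ℕ∞) : WithTop ℕ∞) by norm_num]
    exact_mod_cast le_top
  have hed2 : DifferentiableAt ℝ (fderiv ℝ e) x.1 :=
    ((hez x.1 hx).fderiv_right (m := 1) h2top).differentiableAt one_ne_zero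
  have hgBd2 : DifferentiableAt ℝ (fderiv ℝ gB) x.1 :=
    ((hgBz x.1 hx).fderiv_right (m := 1) h2top).differentiableAt one_ne_zero
  have hd₂ : ‖fderiv ℝ (fderiv ℝ (fun z ↦ e z + gB z)) x.1 - fderiv ℝ (fderiv ℝ gB) x.1‖ ≤ δ := by
    rw [hfd'.fderiv_eq, fderiv_fun_add hed2 hgBd2]
    have hcancel : fderiv ℝ (fderiv ℝ e) x.1 + fderiv ℝ (fderiv ℝ gB) x.1 - fderiv ℝ (fderiv ℝ gB) x.1 =
        fderiv ℝ (fderiv ℝ e) x.1 := by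
      ext u v w y
      simp
    rw [hcancel, (norm_fderiv_eq_norm_iteratedFDeriv e x.1).2]
    exact hdevk 2 le_rfl
  -- assemble
  have hfin : Module.finrank ℝ E4 = 4 := finrank_euclideanSpace_fin
  rw [hfin] at hmain
  refine hmain.trans ?_
  have hY := norm_nonneg Y
  have hZ := norm_nonneg Z
  have harith := slaving_capstone_arith (n₁ := ‖fderiv ℝ gB x.1‖)
    (n₂ := ‖fderiv ℝ (fderiv ℝ gB) x.1‖) h1s hδ0.le hδ1 hδε (norm_nonneg _)
    (norm_nonneg (fderiv ℝ (fderiv ℝ gB) x.1)) (norm_nonneg _) (norm_nonneg _)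
    (norm_nonneg (fderiv ℝ (fderiv ℝ (fun z ↦ e z + gB z)) x.1 - fderiv ℝ (fderiv ℝ gB) x.1))
    hd₀ hd₁ hd₂
  have := mul_le_mul_of_nonneg_right (mul_le_mul_of_nonneg_right harith hY) hZ
  exact this

/-- **Registered sub-goal form** (worker carrier `slaving_abs_ricAt_ansatz_le_jet` of the crux item) of
`exists_abs_ricAt_ansatz_le_jet`: near each hole at late times the frozen ansatz is Ricci-flat up to
`ε (1 + ‖Dg₀‖² + ‖D²g₀‖)`. [folklore] -/
theorem slaving_abs_ricAt_ansatz_le_jet : open Literature.Geometry.Lorentzian Filter Topology in ∀ {X : Type} [TopologicalSpace X] [ChartedSpace E3 X] [IsManifold (𝓡 3) ((⊤ : ℕ∞) : WithTop ℕ∞) X] [ConnectedSpace X] {D : InitialDataSet (𝓡 3) X} (𝒟 : VacuumCauchyDevelopment D) {N : ℕ} {M a : Fin N → ℝ} {Λ : Fin N → ℝ → lorentzGroup} {ξ : Fin N → ℝ → E3} {γ : ℝ} {U : Opens E4}, (∀ i t, |((Λ i t : E4 ≃L[ℝ] E4) (E4.basisVector 0)) 0| ≤ γ) → (∀ i, ContDiff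 ℝ ((⊤ : ℕ∞) : WithTop ℕ∞) (ξ i) ∧ ContDiff ℝ ((⊤ : ℕ∞) : WithTop ℕ∞) (fun t ↦ ((Λ i t : E4 ≃L[ℝ] E4) : E4 →L[ℝ] E4))) → (∀ i j, i ≠ j → Tendsto (fun t ↦ ‖ξ i t - ξ j t‖) atTop atTop) → ∀ {Φ : U → 𝒟.carrier}, ContMDiff 𝓘(ℝ, E4) (𝓡 4) ((⊤ : ℕ∞) : WithTop ℕ∞) Φ → Tendsto (fun t ↦ 𝒟.toSpacetime.deviationCk ⟨U, fun x ↦ Minkowski.bilin + ∑ i, (boostedKerrBilin (Λ i (x 0)) (E4.ofTimeSpace (x 0) (ξ i (x 0))) (M i) (a i) x - Minkowski.bilin), fun x ↦ x 0, E4.spatialNorm⟩ Φ 2 t) atTop (𝓝 0) → ∀ (i : Fin N) (R : ℝ) {r₀ : ℝ}, 0 < r₀ → ∀ {ε : ℝ}, 0 < ε → ∃ T : ℝ, ∀ x : U, T < x.1 0 → ‖E4.spatial x.1 - ξ i (x.1 0)‖ < R → r₀ < Kerr.radius (a i) (poincareInv (Λ i (x.1 0)) (E4.ofTimeSpace (x.1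 0) (ξ i (x.1 0))) x.1) → ∀ Y Z : E4, |MetricCoord.ricAt (fun z : E4 ↦ Minkowski.bilin + ∑ i, (boostedKerrBilin (Λ i (z 0)) (E4.ofTimeSpace (z 0) (ξ i (z 0))) (M i) (a i) z - Minkowski.bilin)) x.1 Y Z| ≤ ε * (1 + ‖fderiv ℝ (fun z : E4 ↦ Minkowski.bilin + ∑ i, (boostedKerrBilin (Λ i (z 0)) (E4.ofTimeSpace (z 0) (ξ i (z 0))) (M i) (a i) z - Minkowski.bilin)) x.1‖ ^ 2 + ‖fderiv ℝ (fderiv ℝ (fun z : E4 ↦ Minkowski.bilin + ∑ i, (boostedKerrBilin (Λ i (z 0)) (E4.ofTimeSpace (z 0) (ξ i (z 0))) (M i) (a i) z - Minkowski.bilin))) x.1‖) * ‖Y‖ * ‖Z‖ :=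
  fun 𝒟 _ _ _ _ _ _ _ hγ hsm hsep _ hΦ hdev i R _ hr₀ _ hε ↦
    exists_abs_ricAt_ansatz_le_jet 𝒟 hγ hsm hsep hΦ hdev i R hr₀ hε

end Summit.FinalStateConjecture.FinalStateConjecture.Theorems.SublinearIsFree.Slaving

end
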